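import Summits.BirchSwinnertonDyer.BirchSwinnertonDyer.Theorems.UniversalToricDescentStrictPlaceLocalCountPrelim
import HarnessLib

/-!
# The LOCAL TWO-SIDED COUNT at the strict place: `p^{2k p^n} ≤ p^b · #S(n,k)`, `#S(n,k) ≤ p^{2k p^n + b}` for
# `S(n,k) = {y ∈ H¹(kerD κ 𝔭, E[p^∞]) | p^k y = 0, conj_{d₁^{p^n}} y = y}`
# (crux ♭T≤ stmt-BirchSwinnertonDyer-23042, line `sigmacongruence`, stub TS1′ `stub_twinStrictSurj`, brick (1c±) assembled)

Route `UniversalToricDescent`, lead prover `bsd-wall-utd-p1` g17. THEOREMS ONLY (no definition, no named fact, no `sorry`);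
`--supports stmt-BirchSwinnertonDyer-23042`. BSD is not proved by any of this.

Assembly of the three bricks at a place `𝔭 ∣ p` of DEGREE ONE (`#(𝓞_𝔭/p) = p`), finitely decomposed in the `ℤ_p`-extension
`κ` with exact index `κ(D_𝔭) = p^c ℤ_p` (`κ d₁ = p^c`), for an elliptic curve whose local tower torsion
`E[p^∞]^{D_𝔭 ⊓ ker κ}` is finite (`LocalTowerTorsionFiniteAt`):
* `…TowerDescent.twoSided_count_layer` at the profinite group `D_𝔭` with `κ₀ = κ|_{D_𝔭}` (`kerK κ₀ = kerD κ 𝔭` definitionally)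
  and the layer `G_n = κ₀⁻¹(p^{c+n}ℤ_p)`: `#H¹(G_n, A)[p^k] ≤ t · #S(n,k)`, `#S(n,k) ≤ #H¹(G_n, A)[p^k]`;
* `…KummerPow.kummerPow_twoSided` at `G_n ≤ D_𝔭 ≤ Γ_K`: `#H¹(G_n, E[p^k]) ≤ t · #H¹(G_n, A)[p^k] ≤ t · #H¹(G_n, E[p^k])`;
* `…LocalShapiroCount.natCard_H1_subgroup_torsion_bounds` at the completion `F = K_𝔭`, for the open normal subgroup
  `N_n ≤ Γ_F` of index `p^n` corresponding to `G_n` under `Γ_F ≅ D_𝔭` (`absGaloisRangeEquivCompletion`):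
  `p^{2k p^n} ≤ #H¹(N_n, E[p^k]) ≤ t² p^{2k p^n}`;
bridged by `#H¹(G_n, E[p^k]) = #H¹(N_n, E[p^k])` (§2, `resH1Hom` along the two inverse continuous isomorphisms + the tautological
`topRepIsoOfEquiv`). Net (§3 `strictPlace_localCount`): the hypotheses `hfin`, `hlow`, `hup` of the growth-road reduction
`exists_mem_selmerAc_forall_resKerD_eq_of_localCount` (p669209), with `b = 2t`.

References: [GreenbergVatsal2000] §2 Prop. (2.1) (the local terms at `p`); [GreenbergLNM1716] §3 Lemma 3.1–3.3; [MilneADT2006]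
I Thm. 2.8, Cor. 2.3; [Washington1997] §13.1.
-/

set_option autoImplicit false
-- the Theorems namespace of this sub repeats the summit name by design (D-0017 nested layout)
set_option linter.dupNamespace false

noncomputable section

open scoped Classical ValuativeRel
open Function Field NumberField IsDedekindDomain WeierstrassCurve
open Literature.NumberTheory.GaloisRepresentations Literature.NumberTheory.EllipticCurves
  Literature.NumberTheory.EllipticCurves.GreenbergSelmer
  Summit.BirchSwinnertonDyer.Rank1Residual Summit.BirchSwinnertonDyer.Rank1Residual.X11b
  Summit.BirchSwinnertonDyer.Rank1Residual.X11b.Coinv Summit.BirchSwinnertonDyer.Rank1Residual.X11b.ProcyclicDescent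
  Summit.BirchSwinnertonDyer.BirchSwinnertonDyer.Theorems

universe u

namespace Summit.BirchSwinnertonDyer.BirchSwinnertonDyer.Theorems.UniversalToricDescentStrictPlaceLocalCount

/-! ### §2 The bridge `H¹(G_n, E[j]) ≃ H¹(N_n, E[j])` between the decomposition group and the completion -/

section Bridge

variable {K : Type} [Field K] [NumberField K] (W : WeierstrassCurve K) [W.IsElliptic] (p : ℕ) [Fact p.Prime]
  (κ : ZpExtension K p) (𝔭 : HeightOneSpectrum (𝓞 K))

omit [W.IsElliptic] in
/-- **`H¹(G_n, E[j]) ≃ H¹(N_n, E[j])`** for subgroups `G_n ≤ D_𝔭` and `N_n ≤ Γ_{K_𝔭}` cut out by the same divisibility condition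
on `κ` (resp. `κ ∘ res`), along the continuous isomorphism `Γ_{K_𝔭} ≅ D_𝔭` (`absGaloisRangeEquivCompletion`): restriction of
classes both ways (`resH1Hom`) and the tautological identification of the local representation with the restricted global one.
[cite: SerreGaloisCohomology1997, I §2.4, II §1.1] [cite: NeukirchANT1999, Ch. II §9 Prop. (9.6)] -/
theorem nonempty_equiv_local (j : ℕ) [NeZero j] {m : ℕ}
    {Gn : Subgroup (decomp (K := K) 𝔭)} (hGn : ∀ g : decomp (K := K) 𝔭, g ∈ Gn ↔
      (p : ℤ_[p]) ^ m ∣ (κ (g : absoluteGaloisGroup K)).toAdd)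
    {Nn : Subgroup (absoluteGaloisGroup (𝔭.adicCompletion K))}
    (hNn : ∀ σ : absoluteGaloisGroup (𝔭.adicCompletion K), σ ∈ Nn ↔
      (p : ℤ_[p]) ^ m ∣ (κ (absGaloisRestrict K (𝔭.adicCompletion K) σ)).toAdd) :
    Nonempty (subgroupH1 Gn (WeierstrassCurve.geomTorsion W (j : ℤ)) ≃
      continuousCohomology 1 (subgroupRep
        (GaloisRep.restrictField (𝔭.adicCompletion K) (W.torsionGaloisModule (j : ℤ))).toTopRep Nn)) := by
  let F := 𝔭.adicCompletion K
  let M : Type := WeierstrassCurve.geomTorsion W (j : ℤ)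
  let π : absoluteGaloisGroup F →ₜ* absoluteGaloisGroup K := absGaloisRestrict K F
  letI instF : DistribMulAction (absoluteGaloisGroup F) M :=
    DistribMulAction.compHom M (π : absoluteGaloisGroup F →* absoluteGaloisGroup K)
  let e := absGaloisRangeEquivCompletion K 𝔭
  have hθmem : ∀ σ : Nn, (⟨π (σ : absoluteGaloisGroup F),
      (mem_decomp_iff 𝔭 _).mpr ⟨(σ : absoluteGaloisGroup F), rfl⟩⟩ : decomp (K := K) 𝔭) ∈ Gn := fun σ ↦
    (hGn _).mpr ((hNn σ).mp σ.2)
  let θ : Nn →ₜ* Gn :=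
    { toFun := fun σ ↦ ⟨⟨π (σ : absoluteGaloisGroup F), (mem_decomp_iff 𝔭 _).mpr ⟨(σ : absoluteGaloisGroup F), rfl⟩⟩, hθmem σ⟩
      map_one' := Subtype.ext (Subtype.ext (map_one π))
      map_mul' := fun a b ↦ Subtype.ext (Subtype.ext (map_mul π (a : absoluteGaloisGroup F) (b : absoluteGaloisGroup F)))
      continuous_toFun := ((π.continuous.comp continuous_subtype_val).subtype_mk fun σ : Nn ↦
        (mem_decomp_iff 𝔭 _).mpr ⟨(σ : absoluteGaloisGroup F), rfl⟩).subtype_mk fun σ ↦ hθmem σ }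
  have hθ'res : ∀ g : Gn, π (e.symm ⟨((g : decomp (K := K) 𝔭) : absoluteGaloisGroup K), (g : decomp (K := K) 𝔭).2⟩) =
      ((g : decomp (K := K) 𝔭) : absoluteGaloisGroup K) := fun g ↦
    absGaloisRestrict_absGaloisRangeEquivCompletion_symm K 𝔭 _
  have hθ'mem : ∀ g : Gn, e.symm ⟨((g : decomp (K := K) 𝔭) : absoluteGaloisGroup K), (g : decomp (K := K) 𝔭).2⟩ ∈ Nn :=
    fun g ↦ by
    rw [hNn]
    change (p : ℤ_[p]) ^ m ∣ (κ (π (e.symm _))).toAdd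
    rw [hθ'res]
    exact (hGn _).mp g.2
  let θ' : Gn →ₜ* Nn :=
    { toFun := fun g ↦ ⟨e.symm ⟨((g : decomp (K := K) 𝔭) : absoluteGaloisGroup K), (g : decomp (K := K) 𝔭).2⟩, hθ'mem g⟩
      map_one' := Subtype.ext (by
        change e.symm ⟨(((1 : Gn) : decomp (K := K) 𝔭) : absoluteGaloisGroup K), _⟩ = 1
        rw [← map_one e.symm]
        rfl)
      map_mul' := fun x y ↦ Subtype.ext (by
        change e.symm ⟨(((x * y : Gn) : decomp (K := K) 𝔭) : absoluteGaloisGroup K), _⟩ =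
          e.symm ⟨((x : decomp (K := K) 𝔭) : absoluteGaloisGroup K), (x : decomp (K := K) 𝔭).2⟩ *
            e.symm ⟨((y : decomp (K := K) 𝔭) : absoluteGaloisGroup K), (y : decomp (K := K) 𝔭).2⟩
        rw [← map_mul e.symm]
        rfl)
      continuous_toFun := (e.symm.continuous.comp ((continuous_subtype_val.comp continuous_subtype_val).subtype_mk
        fun g : Gn ↦ (g : decomp (K := K) 𝔭).2)).subtype_mk fun g ↦ hθ'mem g }
  have hθθ' : θ.comp θ' = ContinuousMonoidHom.id _ :=
    ContinuousMonoidHom.ext fun g ↦ Subtype.ext (Subtype.ext (hθ'res g))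
  have hθ'θ : θ'.comp θ = ContinuousMonoidHom.id _ := ContinuousMonoidHom.ext fun σ ↦ Subtype.ext
    (absGaloisRestrict_adicCompletion_injective K 𝔭 (absGaloisRestrict_absGaloisRangeEquivCompletion_symm K 𝔭 _))
  -- the two restrictions of classes
  let r₁ : discreteH1 Gn M →+ discreteH1 Nn M := resH1Hom θ (AddMonoidHom.id M) fun _ _ ↦ rfl
  have h₂ : ∀ (g : Gn) (x : M), (AddMonoidHom.id M) (θ' g • x) = g • (AddMonoidHom.id M) x := fun g x ↦ by
    change π (e.symm _) • x = ((g : decomp (K := K) 𝔭) : absoluteGaloisGroup K) • x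
    rw [hθ'res]
  let r₂ : discreteH1 Nn M →+ discreteH1 Gn M := resH1Hom θ' (AddMonoidHom.id M) h₂
  have e1 : resH1Hom (θ.comp θ') ((AddMonoidHom.id M).comp (AddMonoidHom.id M))
      (fun g x ↦ by change π (e.symm _) • x = _; rw [hθ'res]; rfl) =
      resH1Hom (ContinuousMonoidHom.id _) (AddMonoidHom.id M) (fun _ _ ↦ rfl) :=
    resH1Hom_congr hθθ' (AddMonoidHom.comp_id _) _ _
  have e2 : resH1Hom (θ'.comp θ) ((AddMonoidHom.id M).comp (AddMonoidHom.id M))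
      (fun σ x ↦ by
        change π (e.symm _) • x = π (σ : absoluteGaloisGroup F) • x
        rw [absGaloisRestrict_absGaloisRangeEquivCompletion_symm]
        rfl) =
      resH1Hom (ContinuousMonoidHom.id _) (AddMonoidHom.id M) (fun _ _ ↦ rfl) :=
    resH1Hom_congr hθ'θ (AddMonoidHom.comp_id _) _ _
  have hc1 : r₂.comp r₁ = AddMonoidHom.id _ := by rw [resH1Hom_comp, e1, resH1Hom_id]
  have hc2 : r₁.comp r₂ = AddMonoidHom.id _ := by rw [resH1Hom_comp, e2, resH1Hom_id]
  let eH : discreteH1 Gn M ≃ discreteH1 Nn M :=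
    { toFun := r₁, invFun := r₂, left_inv := fun x ↦ DFunLike.congr_fun hc1 x, right_inv := fun y ↦ DFunLike.congr_fun hc2 y }
  -- the tautological identification of `M|_{N_n}` with the restricted global representation
  let ι : discreteTopRep Nn M ≅
      subgroupRep (GaloisRep.restrictField F (W.torsionGaloisModule (j : ℤ))).toTopRep Nn :=
    topRepIsoOfEquiv (X := discreteTopRep Nn M)
      (Y := subgroupRep (GaloisRep.restrictField F (W.torsionGaloisModule (j : ℤ))).toTopRep Nn)
      (ContinuousLinearEquiv.refl ℤ M) fun _ _ ↦ rfl
  exact ⟨eH.trans (continuousCohomologyEquivOfIso ι 1)⟩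

end Bridge

/-! ### §3 The local two-sided count at the strict place -/

section Assembly

variable {K : Type} [Field K] [NumberField K] (W : WeierstrassCurve K) [W.IsElliptic] (p : ℕ) [Fact p.Prime]
  (κ : ZpExtension K p) (𝔭 : HeightOneSpectrum (𝓞 K))

/-- **The LOCAL TWO-SIDED COUNT at a degree-one place finitely decomposed in `κ`** (brick (1c±) of the growth road): with
`S(n,k) = {y ∈ H¹(kerD κ 𝔭, E[p^∞]) | p^k y = 0, conj_{d₁^{p^n}} y = y}`, `κ d₁ = p^c` the exact index, `#(𝓞_𝔭/p) = p`, and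
`E[p^∞]^{D_𝔭 ⊓ ker κ}` finite: there is `b` with `S(n,k)` finite, `p^{2 p^n k} ≤ p^b · #S(n,k)` and `#S(n,k) ≤ p^{2 p^n k + b}` for
all `n, k`. See the module docstring for the chain. [cite: GreenbergVatsal2000, §2 Prop. (2.1) (local terms at `p`)]
[cite: GreenbergLNM1716, §3 Lemma 3.1–3.3] [cite: MilneADT2006, I Thm. 2.8, Cor. 2.3] -/
theorem strictPlace_localCount
    (hO : Nat.card (𝔭.adicCompletionIntegers K ⧸ Ideal.span {(p : 𝔭.adicCompletionIntegers K)}) = p)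
    (hfinT : SchneiderFreeControlAtoms.LocalTowerTorsionFiniteAt W p κ 𝔭)
    {c : ℕ} {d₁ : decomp (K := K) 𝔭} (hd₁ : (κ (d₁ : absoluteGaloisGroup K)).toAdd = (p : ℤ_[p]) ^ c)
    (hc : ∀ z : ℤ_[p], ∃ d : decomp (K := K) 𝔭, (κ (d : absoluteGaloisGroup K)).toAdd = (p : ℤ_[p]) ^ c * z)
    (hdvd : ∀ d : decomp (K := K) 𝔭, (p : ℤ_[p]) ^ c ∣ (κ (d : absoluteGaloisGroup K)).toAdd) :
    ∃ b : ℕ, ∀ n k : ℕ,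
      Set.Finite {y : subgroupH1 (kerD κ 𝔭) (W.geomPrimaryTorsion p) |
        p ^ k • y = 0 ∧ conjH1 (kerD κ 𝔭) (W.geomPrimaryTorsion p) (d₁ ^ p ^ n) y = y} ∧
      p ^ (2 * p ^ n * k) ≤ p ^ b * Nat.card {y : subgroupH1 (kerD κ 𝔭) (W.geomPrimaryTorsion p) //
        p ^ k • y = 0 ∧ conjH1 (kerD κ 𝔭) (W.geomPrimaryTorsion p) (d₁ ^ p ^ n) y = y} ∧
      Nat.card {y : subgroupH1 (kerD κ 𝔭) (W.geomPrimaryTorsion p) //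
        p ^ k • y = 0 ∧ conjH1 (kerD κ 𝔭) (W.geomPrimaryTorsion p) (d₁ ^ p ^ n) y = y} ≤ p ^ (2 * p ^ n * k + b) := by
  have hp : p.Prime := Fact.out
  haveI : CompactSpace (absoluteGaloisGroup K) := absoluteGaloisGroup_compactSpace K
  haveI : CompactSpace (decomp (K := K) 𝔭) := isCompact_iff_compactSpace.mp (isClosed_decomp 𝔭).isCompact
  -- notation
  let A : Type := W.geomPrimaryTorsion p
  let G : Type := decomp (K := K) 𝔭
  let κ₀ : G →ₜ* Multiplicative ℤ_[p] := kappaD κ 𝔭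
  have hκ₀ : ∀ g : G, κ₀ g = κ (g : absoluteGaloisGroup K) := fun _ ↦ rfl
  let F : Type := 𝔭.adicCompletion K
  haveI : CharZero F := charZero_of_injective_algebraMap (algebraMap K F).injective
  haveI : CompactSpace (absoluteGaloisGroup F) := absoluteGaloisGroup_compactSpace F
  let π : absoluteGaloisGroup F →ₜ* absoluteGaloisGroup K := absGaloisRestrict K F
  let χ : absoluteGaloisGroup F →ₜ* Multiplicative ℤ_[p] := κ.toContinuousMonoidHom.comp π
  have hχ : ∀ σ, χ σ = κ (π σ) := fun _ ↦ rfl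
  let eF := absGaloisRangeEquivCompletion K 𝔭
  -- the finite group `T = E[p^∞]^{D_𝔭 ⊓ ker κ}` in the currency of `…TowerDescent`
  have eT : {a : A // ∀ g : G, κ₀ g = 1 → g • a = a} ≃
      (FixedPoints.addSubgroup (decomp (K := K) 𝔭 ⊓ κ.kerSubgroup : Subgroup (absoluteGaloisGroup K)) A :
        Set A) := by
    refine Equiv.subtypeEquivRight fun a ↦ ⟨fun h x ↦ ?_, fun h g hg ↦ ?_⟩
    · have hx := Subgroup.mem_inf.mp x.2
      exact h ⟨(x : absoluteGaloisGroup K), hx.1⟩ (ZpExtension.mem_kerSubgroup.mp hx.2)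
    · exact h ⟨(g : absoluteGaloisGroup K), Subgroup.mem_inf.mpr ⟨g.2, ZpExtension.mem_kerSubgroup.mpr hg⟩⟩
  haveI hTfin : Finite {a : A // ∀ g : G, κ₀ g = 1 → g • a = a} := by
    haveI := hfinT.to_subtype
    exact Finite.of_equiv _ eT.symm
  haveI : Nonempty {a : A // ∀ g : G, κ₀ g = 1 → g • a = a} := ⟨⟨0, fun g _ ↦ smul_zero _⟩⟩
  set t : ℕ := Nat.card {a : A // ∀ g : G, κ₀ g = 1 → g • a = a} with ht
  have htpos : 0 < t := Nat.card_pos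
  have ht2 : t * t ≤ p ^ (2 * t) := by
    rw [two_mul, pow_add]
    exact Nat.mul_le_mul (Nat.lt_pow_self hp.one_lt).le (Nat.lt_pow_self hp.one_lt).le
  refine ⟨2 * t, fun n k ↦ ?_⟩
  -- abbreviation for the counted set
  set P : subgroupH1 (kerD κ 𝔭) A → Prop := fun y ↦ p ^ k • y = 0 ∧ conjH1 (kerD κ 𝔭) A (d₁ ^ p ^ n) y = y with hP
  change Set.Finite {y | P y} ∧ p ^ (2 * p ^ n * k) ≤ p ^ (2 * t) * Nat.card {y // P y} ∧
    Nat.card {y // P y} ≤ p ^ (2 * p ^ n * k + 2 * t)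
  -- the case `k = 0`: `S = {0}`
  rcases Nat.eq_zero_or_pos k with rfl | hk
  · have hP0 : ∀ y, P y ↔ y = 0 := fun y ↦ by
      rw [hP]
      constructor
      · rintro ⟨h, -⟩
        rwa [pow_zero, one_smul] at h
      · rintro rfl
        exact ⟨smul_zero _, map_zero _⟩
    have hset : {y | P y} = {0} := Set.ext fun y ↦ by rw [Set.mem_setOf_eq, hP0, Set.mem_singleton_iff]
    have hcard : Nat.card {y // P y} = 1 := by
      rw [Nat.card_eq_one_iff_exists]
      exact ⟨⟨0, (hP0 0).mpr rfl⟩, fun y ↦ Subtype.ext ((hP0 y.1).mp y.2)⟩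
    refine ⟨hset ▸ Set.finite_singleton 0, ?_, ?_⟩
    · rw [hcard, mul_zero, pow_zero, mul_one]
      exact Nat.one_le_pow _ _ hp.pos
    · rw [hcard, mul_zero, zero_add]
      exact Nat.one_le_pow _ _ hp.pos
  -- the layer `G_n ≤ D_𝔭` and its local avatar `N_n ≤ Γ_F`
  obtain ⟨Gn, hGn⟩ := exists_layer κ₀ (c + n)
  obtain ⟨Nn, hNn⟩ := exists_layer χ (c + n)
  have hGn' : ∀ g : G, g ∈ Gn ↔ (p : ℤ_[p]) ^ (c + n) ∣ (κ (g : absoluteGaloisGroup K)).toAdd := hGn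
  have hNn' : ∀ σ, σ ∈ Nn ↔ (p : ℤ_[p]) ^ (c + n) ∣ (κ (π σ)).toAdd := hNn
  have hd₁' : (κ₀ d₁).toAdd = (p : ℤ_[p]) ^ c := hd₁
  haveI : Gn.Normal := UniversalToricDescentTowerDescent.normal_layer κ₀ hGn
  haveI : Nn.Normal := UniversalToricDescentTowerDescent.normal_layer χ hNn
  have hGc : IsClosed (Gn : Set G) := isClosed_layer κ₀ hGn
  have hNopen : IsOpen (Nn : Set (absoluteGaloisGroup F)) := isOpen_layer χ hNn
  haveI hNQ : Finite (absoluteGaloisGroup F ⧸ Nn) := Subgroup.quotient_finite_of_isOpen Nn hNopen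
  -- the index `[Γ_F : N_n] = p^n` (exact index of `χ` via `δ₁' = res⁻¹ d₁`)
  let δ₁' : absoluteGaloisGroup F := eF.symm ⟨(d₁ : absoluteGaloisGroup K), d₁.2⟩
  have hπδ : π δ₁' = (d₁ : absoluteGaloisGroup K) := absGaloisRestrict_absGaloisRangeEquivCompletion_symm K 𝔭 _
  have hδ₁'' : (χ δ₁').toAdd = (p : ℤ_[p]) ^ c := by rw [hχ, hπδ]; exact hd₁
  have hdvd' : ∀ σ : absoluteGaloisGroup F, (p : ℤ_[p]) ^ c ∣ (χ σ).toAdd := fun σ ↦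
    hdvd ⟨π σ, (mem_decomp_iff 𝔭 _).mpr ⟨σ, rfl⟩⟩
  have hidx : Nat.card (absoluteGaloisGroup F ⧸ Nn) = p ^ n := natCard_quotient_layer χ hδ₁'' hdvd' hNn
  -- the local count (brick (d))
  obtain ⟨ρC, hρC⟩ := UniversalToricDescentLocalShapiroCount.exists_continuousRep_coind
    (GaloisRep.restrictField F (W.torsionGaloisModule (p ^ k : ℕ))) Nn hNopen
  have hfixle : Nat.card {T : WeierstrassCurve.geomTorsion W ((p ^ k : ℕ) : ℤ) //
      ∀ g : absoluteGaloisGroup F, g ∈ Nn → GaloisRep.restrictField F (W.torsionGaloisModule (p ^ k : ℕ)) g T = T} ≤ t := by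
    rw [ht]
    refine Nat.card_le_card_of_injective (fun T ↦ ⟨AddSubgroup.inclusion
      (Literature.Barriers.BirchSwinnertonDyer.geomTorsion_pow_le_geomPrimaryTorsion W p k) T.1, fun g hg ↦ ?_⟩) ?_
    · -- `g ∈ kerD`: `g = π σ` with `σ ∈ N_n`
      let σ : absoluteGaloisGroup F := eF.symm ⟨(g : absoluteGaloisGroup K), g.2⟩
      have hπσ : π σ = (g : absoluteGaloisGroup K) := absGaloisRestrict_absGaloisRangeEquivCompletion_symm K 𝔭 _
      have hσ : σ ∈ Nn := by
        rw [hNn', hπσ, ← hκ₀, hg, toAdd_one]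
        exact dvd_zero _
      have h1 := T.2 σ hσ
      change (π σ) • T.1 = T.1 at h1
      rw [hπσ] at h1
      exact congrArg (AddSubgroup.inclusion _) h1
    · intro T₁ T₂ h
      have h' := congrArg Subtype.val h
      exact Subtype.ext (AddSubgroup.inclusion_injective _ h')
  obtain ⟨hLfin, hLlow, hLup⟩ := UniversalToricDescentLocalShapiroCount.natCard_H1_subgroup_torsion_bounds W F p k hk Nn
    hNopen ρC hρC hfixle
  rw [hidx] at hLlow hLup
  -- the `𝓞`-factor: `#(𝓞_𝔭 / p^{2 k p^n}) = p^{2 k p^n}`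
  have hOq : Nat.card (𝒪[F] ⧸ Ideal.span {((p ^ (2 * k * p ^ n) : ℕ) : 𝒪[F])}) = p ^ (2 * k * p ^ n) := by
    rw [natCard_integer_quotient_natCast_eq K 𝔭,
      Summit.BirchSwinnertonDyer.Rank1Residual.Additive.DefectCountFiniteLevel.natCard_quot_adicCompletionIntegers_natCast_pow
        𝔭 hp.ne_zero, hO]
  rw [hOq] at hLlow hLup
  -- the bridge `H¹(G_n, E[p^k]) ≃ H¹(N_n, E[p^k])`
  haveI : NeZero (p ^ k : ℕ) := ⟨pow_ne_zero k hp.ne_zero⟩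
  obtain ⟨eqv⟩ := nonempty_equiv_local W p κ 𝔭 (p ^ k) hGn' hNn'
  haveI := hLfin
  haveI hHkfin : Finite (subgroupH1 Gn (WeierstrassCurve.geomTorsion W ((p ^ k : ℕ) : ℤ))) := Finite.of_equiv _ eqv.symm
  have hHk : Nat.card (subgroupH1 Gn (WeierstrassCurve.geomTorsion W ((p ^ k : ℕ) : ℤ))) =
      Nat.card (continuousCohomology 1 (subgroupRep
        (GaloisRep.restrictField F (W.torsionGaloisModule ((p ^ k : ℕ) : ℤ))).toTopRep Nn)) := Nat.card_congr eqv
  -- Kummer (brick (c)) at `G_n ≤ D_𝔭 ≤ Γ_K`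
  have hFixle : Nat.card (FixedPoints.addSubgroup Gn A) ≤ t ∧ Finite (FixedPoints.addSubgroup Gn A) := by
    have hinj : Function.Injective (fun a : FixedPoints.addSubgroup Gn A ↦
        (⟨a.1, fun g hg ↦ a.2 ⟨g, UniversalToricDescentTowerDescent.kerK_le_layer κ₀ hGn hg⟩⟩ :
          {a : A // ∀ g : G, κ₀ g = 1 → g • a = a})) := fun a b h ↦ by
      have h' := congrArg Subtype.val h
      exact Subtype.ext h'
    exact ⟨ht ▸ Nat.card_le_card_of_injective _ hinj, Finite.of_injective _ hinj⟩
  haveI := hFixle.2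
  obtain ⟨hXkfin, hK1, hK2⟩ := UniversalToricDescentKummerPow.kummerPow_twoSided W p Gn k
  -- procyclic descent at the layer (bricks (a)(b))
  haveI := hXkfin
  have hA : ∀ a : A, IsOpen {g : G | g • a = a} := fun a ↦
    (Summit.BirchSwinnertonDyer.Rank1Residual.X11b.LocBridge.isOpen_stabilizer_geomPrimaryTorsion W p a).preimage continuous_subtype_val
  obtain ⟨hSfin, hT1, hT2⟩ := UniversalToricDescentTowerDescent.twoSided_count_layer κ₀ hd₁' hGn hA
    (isPrimaryTorsion_geomPrimaryTorsion W p) hGc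
    (fun y ↦ UniversalToricDescentSigmaLocalStabilizer.exists_forall_dvd_imp_conjH1_kerD_eq κ
      (Summit.BirchSwinnertonDyer.Rank1Residual.X11b.LocBridge.isOpen_stabilizer_geomPrimaryTorsion W p) 𝔭 hc y) k
  -- assemble
  refine ⟨hSfin, ?_, ?_⟩
  · -- lower bound
    have e1 : 2 * p ^ n * k = 2 * k * p ^ n := by ring
    rw [e1]
    calc p ^ (2 * k * p ^ n) ≤ _ := hLlow
      _ = Nat.card (subgroupH1 Gn (WeierstrassCurve.geomTorsion W ((p ^ k : ℕ) : ℤ))) := hHk.symm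
      _ ≤ Nat.card (FixedPoints.addSubgroup Gn A) * _ := hK1
      _ ≤ t * _ := Nat.mul_le_mul_right _ hFixle.1
      _ ≤ t * (t * _) := Nat.mul_le_mul_left _ hT1
      _ = t * t * _ := (mul_assoc _ _ _).symm
      _ ≤ p ^ (2 * t) * _ := Nat.mul_le_mul_right _ ht2
  · -- upper bound
    have e1 : 2 * p ^ n * k + 2 * t = 2 * t + 2 * k * p ^ n := by ring
    rw [e1, pow_add]
    calc Nat.card {y // P y} ≤ _ := hT2
      _ ≤ Nat.card (subgroupH1 Gn (WeierstrassCurve.geomTorsion W ((p ^ k : ℕ) : ℤ))) := hK2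
      _ = _ := hHk
      _ ≤ t ^ 2 * p ^ (2 * k * p ^ n) := hLup
      _ ≤ p ^ (2 * t) * p ^ (2 * k * p ^ n) := Nat.mul_le_mul_right _ (by rw [sq]; exact ht2)

end Assembly

end Summit.BirchSwinnertonDyer.BirchSwinnertonDyer.Theorems.UniversalToricDescentStrictPlaceLocalCount

end
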